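import Literature.Geometry.Riemannian.CylinderChartComponents
import Literature.Geometry.Lorentzian.CoordCylinderFunctional
import Literature.Geometry.Lorentzian.CoordEntropyEvolution
import HarnessLib

/-!
# Formula (9) in coordinates, printed form (Bär–Hanke 2023, §3, (9))

Topic `Literature/Geometry/Riemannian`. A small brick of the proof of the named fact
`Literature.Geometry.Riemannian.BarHanke2023_thm27_umbilicNormalForm`. The chart dictionary of
`CylinderChartComponents.lean` reads the scalar curvature of a Riemannian generalized cylinder
`G = g_t + dt²` on `N × ℝ` in a chart `ψ` of `N` in the `H`-form
`scal_G = scalAt F(·,t) − |½Ḟ|² − (tr ½Ḟ)² − 2 ∂_t tr_{F(·,t)}(½Ḟ)` (`cyl_scalarCurvature_eq_coord`,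
`F(y, t)` the slice components). Here we convert it to the **printed form** of Bär–Hanke (9),

  `scal_G(ψ⁻¹ p, t) = scalAt F(·,t) p + 3 |½Ḟ|² − (tr ½Ḟ)² − tr_{F(·,t)} F̈`   (`Ḟ = ∂_t F`, `F̈ = ∂²_t F` at `(p, t)`),

using `∂_t tr_{F_t} Ḟ_t = tr_{F_t} F̈_t − |Ḟ_t|²` (`IsMetricFamilyOn.hasDerivWithinAt_mtrAt_tDeriv`,
`CoordCylinderFunctional.lean`) for the metric family `t ↦ F(·, t)` on `ψ.target × ℝ`
(`isMetricFamilyOn_cylComponents`). This is the form in which the pointwise estimates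
`MetricCoord.stepA_pointwise` / `MetricCoord.stepB_pointwise` are stated.
Everything is proved; no definitions, no named facts (D-0026).

## References

* C. Bär, B. Hanke, *Boundary conditions for scalar curvature*, arXiv:2012.09127, §3, (8)–(9).
  [BarHanke2023]
* P. Topping, *Lectures on the Ricci flow* (2006), §2.3.2 (`∂_t g⁻¹ = −g⁻¹ ġ g⁻¹`). [Topping2006]
-/

noncomputable section

set_option maxSynthPendingDepth 3

open Bundle Set Filter Function Metric TopologicalSpace
open scoped Manifold ContDiff Topology

namespace Literature.Geometry.Riemannian

open Literature.Geometry.Lorentzian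
open Literature.Geometry.Lorentzian.PseudoRiemannianMetric
open Literature.Geometry.Lorentzian.MetricCoord

variable {E' : Type*} [NormedAddCommGroup E'] [InnerProductSpace ℝ E'] [FiniteDimensional ℝ E']
  {N : Type*} [TopologicalSpace N] [ChartedSpace E' N] [IsManifold 𝓘(ℝ, E') ∞ N]
  (G : PseudoRiemannianMetric (𝓘(ℝ, E').prod 𝓘(ℝ, ℝ)) ∞ (E' × ℝ)
    (TangentSpace (𝓘(ℝ, E').prod 𝓘(ℝ, ℝ)) : N × ℝ → Type _)) [G.HasLeviCivita]
  {ψ : OpenPartialHomeomorph N E'}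
  (hG : G.IsRiemannian)
  (hcyl : ∀ (p : N × ℝ) (v w : TangentSpace (𝓘(ℝ, E').prod 𝓘(ℝ, ℝ)) p),
    G.val p v w = G.val p ((v.1, 0) : TangentSpace (𝓘(ℝ, E').prod 𝓘(ℝ, ℝ)) p)
      ((w.1, 0) : TangentSpace (𝓘(ℝ, E').prod 𝓘(ℝ, ℝ)) p) + v.2 * w.2)
  (hψ : ψ ∈ IsManifold.maximalAtlas 𝓘(ℝ, E') ∞ N)
  (F : E' → ℝ → E' →L[ℝ] E' →L[ℝ] ℝ)
  (hF : ∀ (y : E') (s : ℝ), F y s = MaxAtlasChart.metricRepr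
    (G.inducedMetric (fun x : N ↦ ((x, s) : N × ℝ))
      (contMDiff_pullbackBilin_holds (I := 𝓘(ℝ, E').prod 𝓘(ℝ, ℝ)) (M := N × ℝ)
        (I' := 𝓘(ℝ, E')) (N := N))
      (isSpacelikeImmersion_cylSlice G hG s)) hψ y)

include hF

omit [G.HasLeviCivita] in
/-- The slice components form a smooth metric family on `ψ.target × ℝ` (`IsMetricFamilyOn`, time
set `univ`). [folklore] -/
theorem isMetricFamilyOn_cylComponents : IsMetricFamilyOn (fun s y ↦ F y s) univ ψ.target := by
  refine ⟨fun t _ ↦ ?_, contDiffOn_cylComponents G hG hψ F hF, uniqueDiffOn_univ, by simp⟩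
  have hfun : (fun y ↦ F y t) = MaxAtlasChart.metricRepr
      (G.inducedMetric (fun x : N ↦ ((x, t) : N × ℝ))
        (contMDiff_pullbackBilin_holds (I := 𝓘(ℝ, E').prod 𝓘(ℝ, ℝ)) (M := N × ℝ)
          (I' := 𝓘(ℝ, E')) (N := N))
        (isSpacelikeImmersion_cylSlice G hG t)) hψ := funext fun y ↦ hF y t
  rw [hfun]
  exact MaxAtlasChart.isMetricOn_metricRepr _ hψ

omit [G.HasLeviCivita] in
/-- **`∂_t tr_{F_t}(½Ḟ) = ½ (tr_{F_t} F̈ − |Ḟ|²)`** at a point of the target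
(`IsMetricFamilyOn.hasDerivWithinAt_mtrAt_tDeriv`). [cite: BarHanke2023, §3, (9)] -/
theorem hasDerivAt_mtrAt_half_deriv (p : MaxAtlasChart.target ψ) (t : ℝ) :
    HasDerivAt (fun τ ↦ mtrAt (fun y ↦ F y τ) p ((2⁻¹ : ℝ) • deriv (fun s : ℝ ↦ F p s) τ))
      (2⁻¹ * (mtrAt (fun y ↦ F y t) p (deriv (fun s ↦ deriv (fun σ : ℝ ↦ F p σ) s) t) -
        normSqAt (fun y ↦ F y t) p (deriv (fun s : ℝ ↦ F p s) t))) t := by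
  have hfam := isMetricFamilyOn_cylComponents G hG hψ F hF
  have hd := hfam.hasDerivWithinAt_mtrAt_tDeriv (x := (p : E')) (t := t) p.2 (mem_univ t)
  simp only [tDeriv, derivWithin_univ] at hd
  have hd' : HasDerivAt (fun s ↦ mtrAt (fun y ↦ F y s) p (deriv (fun s : ℝ ↦ F p s) s))
      (mtrAt (fun y ↦ F y t) p (deriv (fun s ↦ deriv (fun σ : ℝ ↦ F p σ) s) t) -
        normSqAt (fun y ↦ F y t) p (deriv (fun s : ℝ ↦ F p s) t)) t :=
    hd.hasDerivAt (univ_mem)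
  have hfun : (fun τ ↦ mtrAt (fun y ↦ F y τ) p ((2⁻¹ : ℝ) • deriv (fun s : ℝ ↦ F p s) τ)) =
      fun τ ↦ 2⁻¹ * mtrAt (fun y ↦ F y τ) p (deriv (fun s : ℝ ↦ F p s) τ) :=
    funext fun τ ↦ mtrAt_smul _ _ _ _
  rw [hfun]
  exact hd'.const_mul 2⁻¹

include hcyl

/-- **Formula (9) in coordinates, printed form** (Bär–Hanke 2023, §3, (9):
`scal_G = scal_{g_t} + 3 tr(W_t²) − tr(W_t)² − tr_{g_t}(g̈_t)`): at `(ψ⁻¹ p, t)`,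
`scal_G = scalAt F(·,t) p + 3 normSqAt (½Ḟ) − (mtrAt (½Ḟ))² − mtrAt F̈` with `Ḟ = ∂_t F(p,t)`,
`F̈ = ∂²_t F(p,t)` (from the `H`-form `cyl_scalarCurvature_eq_coord` and
`hasDerivAt_mtrAt_half_deriv`). [cite: BarHanke2023, §3, (9)] -/
theorem cyl_scalarCurvature_eq_coord_printed (p : MaxAtlasChart.target ψ) (t : ℝ) :
    G.scalarCurvature (ψ.symm p, t) =
      MetricCoord.scalAt (fun y ↦ F y t) p +
        3 * MetricCoord.normSqAt (fun y ↦ F y t) p ((2⁻¹ : ℝ) • deriv (fun s : ℝ ↦ F p s) t) -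
        MetricCoord.mtrAt (fun y ↦ F y t) p ((2⁻¹ : ℝ) • deriv (fun s : ℝ ↦ F p s) t) ^ 2 -
        MetricCoord.mtrAt (fun y ↦ F y t) p (deriv (fun s ↦ deriv (fun σ : ℝ ↦ F p σ) s) t) := by
  rw [cyl_scalarCurvature_eq_coord G hG hcyl hψ F hF p t,
    (hasDerivAt_mtrAt_half_deriv G hG hψ F hF p t).deriv, normSqAt_smul]
  ring

end Literature.Geometry.Riemannian

end
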